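import Summits.AtomisticToContinuum.Crystallization.Theorems.ChartedZeroExcessLayeredLatticeLiouvilleYIA

/-!
# Charted zero-excess layered-lattice Liouville — YI «ColdMoatDial + MildDoorVariationalSplit» — part 2 of 3 (sequel of `…ChartedZeroExcessLayeredLatticeLiouvilleYIA`)

Split for the 400-line cap by the landing lane (hand-2 g32); the module docstring of part 1 (`…ChartedZeroExcessLayeredLatticeLiouvilleYIA`) describes the whole node.  Same namespace; all FQNs unchanged.
0 sorry; standard axioms.
-/

noncomputable section
open scoped BigOperators Classical
open MeasureTheory Set Metric Filter Topology
open Summit.AtomisticToContinuum.Crystallization.Theorems.ChartedPlanarOrderRigidityDoor (E3 eStar atomsIn IsEStarGSC siteEnergy VisibleGap PertRegime)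
open Summit.AtomisticToContinuum.Crystallization.Theorems.ChartedPlanarOrderDensityDichotomy (μS IsSep nK nK_nonneg)
open Summit.AtomisticToContinuum.Crystallization.Theorems.ChartedPlanarOrderCleanScaleP (IsCleanP IsDoorSetP)
open Summit.AtomisticToContinuum.Crystallization.Theorems.ChartedPlanarOrderMesoCut (LayeredHom EnvClose)
open Summit.AtomisticToContinuum.Crystallization.Theorems.ChartedPlanarOrderDoorLayered (atomsIn_subset sq_le_finsum_mem PeriodicBulkGapDoor)
open Summit.AtomisticToContinuum.Crystallization.Theorems.ChartedPlanarOrderDoorLayeredOsc (IsTwoShellAffineGood)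
open Literature.MathematicalPhysics.StatisticalMechanics (card_le_of_separated_of_dist_le lennardJones)

namespace Summit.AtomisticToContinuum.Crystallization.Theorems.ChartedZeroExcessLayeredLatticeLiouville

/-! ### YI-4  The same dials on the MILD serene cut of part YH (column of record-elect `_16XH26B`, CRITIC-LEDGER row 1189 (a″)): moat-level and serenity-radius
monotonicity of the mild doors and mild residuals, the mild cold–wide docket, columns `_16XH28B` / `_16XH28BT` (PROVED) -/

/-- the mild slender count is MONOTONE in the moat level (PROVED). [this file, g65] -/
theorem mildSlenderSereneHotCount_mono_moat {ϑm ϑc ϑ r ra ϑe ωe : ℝ} {p : ℕ} {r₀ ℓ : ℝ} {M : ℕ} {q D b ϑp rp : ℝ} (h : ϑm ≤ ϑc) {S H Q : Set E3}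
    (hQ : Q.Finite) :
    mildSlenderSereneHotCount ϑm ϑ r ra ϑe ωe p r₀ ℓ M q D b ϑp rp S H Q ≤ mildSlenderSereneHotCount ϑc ϑ r ra ϑe ωe p r₀ ℓ M q D b ϑp rp S H Q := by
  rw [mildSlenderSereneHotCount, mildSlenderSereneHotCount, finsum_mem_eq_finite_toFinset_sum _ hQ, finsum_mem_eq_finite_toFinset_sum _ hQ]
  refine Finset.sum_le_sum fun x _ => ?_
  by_cases hm : ¬ IsDressed ϑe ωe p r₀ ℓ M S H x ∧ ¬ IsTameStar ϑ S H x ∧ ¬ IsAgitated ϑm ϑ r ra S H x ∧ IsTameBall ϑp rp S H x ∧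
      ¬ IsHotIsolated ϑ q D S H x ∧ ¬ IsBuried ϑ b S H x
  · rw [if_pos hm, if_pos ⟨hm.1, hm.2.1, fun ha => hm.2.2.1 (ha.of_level_le h), hm.2.2.2.1, hm.2.2.2.2.1, hm.2.2.2.2.2⟩]
  · rw [if_neg hm]
    split_ifs <;> norm_num

/-- the mild slender count is ANTITONE in the serenity radius (PROVED). [this file, g65] -/
theorem mildSlenderSereneHotCount_anti_ra {ϑc ϑ r ra ra' ϑe ωe : ℝ} {p : ℕ} {r₀ ℓ : ℝ} {M : ℕ} {q D b ϑp rp : ℝ} (h : ra ≤ ra') {S H Q : Set E3}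
    (hQ : Q.Finite) :
    mildSlenderSereneHotCount ϑc ϑ r ra' ϑe ωe p r₀ ℓ M q D b ϑp rp S H Q ≤ mildSlenderSereneHotCount ϑc ϑ r ra ϑe ωe p r₀ ℓ M q D b ϑp rp S H Q := by
  rw [mildSlenderSereneHotCount, mildSlenderSereneHotCount, finsum_mem_eq_finite_toFinset_sum _ hQ, finsum_mem_eq_finite_toFinset_sum _ hQ]
  refine Finset.sum_le_sum fun x _ => ?_
  by_cases hm : ¬ IsDressed ϑe ωe p r₀ ℓ M S H x ∧ ¬ IsTameStar ϑ S H x ∧ ¬ IsAgitated ϑc ϑ r ra' S H x ∧ IsTameBall ϑp rp S H x ∧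
      ¬ IsHotIsolated ϑ q D S H x ∧ ¬ IsBuried ϑ b S H x
  · rw [if_pos hm, if_pos ⟨hm.1, hm.2.1, fun ha => hm.2.2.1 (ha.of_ra_le h), hm.2.2.2.1, hm.2.2.2.2.1, hm.2.2.2.2.2⟩]
  · rw [if_neg hm]
    split_ifs <;> norm_num

/-- the mild buried count is MONOTONE in the moat level (PROVED). [this file, g65] -/
theorem mildBuriedSereneHotCount_mono_moat {ϑm ϑc ϑ r ra ϑe ωe : ℝ} {p : ℕ} {r₀ ℓ : ℝ} {M : ℕ} {b ϑp rp : ℝ} (h : ϑm ≤ ϑc) {S H Q : Set E3}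
    (hQ : Q.Finite) :
    mildBuriedSereneHotCount ϑm ϑ r ra ϑe ωe p r₀ ℓ M b ϑp rp S H Q ≤ mildBuriedSereneHotCount ϑc ϑ r ra ϑe ωe p r₀ ℓ M b ϑp rp S H Q := by
  rw [mildBuriedSereneHotCount, mildBuriedSereneHotCount, finsum_mem_eq_finite_toFinset_sum _ hQ, finsum_mem_eq_finite_toFinset_sum _ hQ]
  refine Finset.sum_le_sum fun x _ => ?_
  by_cases hm : ¬ IsDressed ϑe ωe p r₀ ℓ M S H x ∧ ¬ IsTameStar ϑ S H x ∧ ¬ IsAgitated ϑm ϑ r ra S H x ∧ IsTameBall ϑp rp S H x ∧ IsBuried ϑ b S H x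
  · rw [if_pos hm, if_pos ⟨hm.1, hm.2.1, fun ha => hm.2.2.1 (ha.of_level_le h), hm.2.2.2.1, hm.2.2.2.2⟩]
  · rw [if_neg hm]
    split_ifs <;> norm_num

/-- the mild buried count is ANTITONE in the serenity radius (PROVED). [this file, g65] -/
theorem mildBuriedSereneHotCount_anti_ra {ϑc ϑ r ra ra' ϑe ωe : ℝ} {p : ℕ} {r₀ ℓ : ℝ} {M : ℕ} {b ϑp rp : ℝ} (h : ra ≤ ra') {S H Q : Set E3}
    (hQ : Q.Finite) :
    mildBuriedSereneHotCount ϑc ϑ r ra' ϑe ωe p r₀ ℓ M b ϑp rp S H Q ≤ mildBuriedSereneHotCount ϑc ϑ r ra ϑe ωe p r₀ ℓ M b ϑp rp S H Q := by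
  rw [mildBuriedSereneHotCount, mildBuriedSereneHotCount, finsum_mem_eq_finite_toFinset_sum _ hQ, finsum_mem_eq_finite_toFinset_sum _ hQ]
  refine Finset.sum_le_sum fun x _ => ?_
  by_cases hm : ¬ IsDressed ϑe ωe p r₀ ℓ M S H x ∧ ¬ IsTameStar ϑ S H x ∧ ¬ IsAgitated ϑc ϑ r ra' S H x ∧ IsTameBall ϑp rp S H x ∧ IsBuried ϑ b S H x
  · rw [if_pos hm, if_pos ⟨hm.1, hm.2.1, fun ha => hm.2.2.1 (ha.of_ra_le h), hm.2.2.2.1, hm.2.2.2.2⟩]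
  · rw [if_neg hm]
    split_ifs <;> norm_num

/-- ★ **[MSSHSᵇ](ϑc, ra) ⇒ [MSSHSᵇ](ϑm, ra') for `ϑm ≤ ϑc`, `ra ≤ ra'` (PROVED)** — the mild slender residual WEAKENS as the moat cools and the serenity
radius widens. [this file, g65] -/
theorem MildSlenderSereneHotSparseBPG.of_moat_le {ϑm ϑc ϑ r ra ra' ϑe ωe : ℝ} {p : ℕ} {r₀ ℓ : ℝ} {M : ℕ} {q D b ϑp rp aHi Λ θ s : ℝ} (h : ϑm ≤ ϑc)
    (hra : ra ≤ ra') (hS : MildSlenderSereneHotSparseBPG ϑc ϑ r ra ϑe ωe p r₀ ℓ M q D b ϑp rp aHi Λ θ s) :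
    MildSlenderSereneHotSparseBPG ϑm ϑ r ra' ϑe ωe p r₀ ℓ M q D b ϑp rp aHi Λ θ s :=
  CountSparseBPG.of_pointwise_le
    (fun _ _ _ _ hQ _ _ => (mildSlenderSereneHotCount_mono_moat h hQ).trans (mildSlenderSereneHotCount_anti_ra hra hQ)) hS

/-- ★ **[MBSHSᵇ](ϑc, ra) ⇒ [MBSHSᵇ](ϑm, ra') for `ϑm ≤ ϑc`, `ra ≤ ra'` (PROVED)** — the mild buried residual WEAKENS as the moat cools and the serenity
radius widens. [this file, g65] -/
theorem MildBuriedSereneHotSparseBPG.of_moat_le {ϑm ϑc ϑ r ra ra' ϑe ωe : ℝ} {p : ℕ} {r₀ ℓ : ℝ} {M : ℕ} {b ϑp rp aHi Λ θ s : ℝ} (h : ϑm ≤ ϑc)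
    (hra : ra ≤ ra') (hS : MildBuriedSereneHotSparseBPG ϑc ϑ r ra ϑe ωe p r₀ ℓ M b ϑp rp aHi Λ θ s) :
    MildBuriedSereneHotSparseBPG ϑm ϑ r ra' ϑe ωe p r₀ ℓ M b ϑp rp aHi Λ θ s :=
  CountSparseBPG.of_pointwise_le
    (fun _ _ _ _ hQ _ _ => (mildBuriedSereneHotCount_mono_moat h hQ).trans (mildBuriedSereneHotCount_anti_ra hra hQ)) hS

/-- ★ **[MCMC](ϑc) ⇒ [MCMC](ϑm) for `ϑm ≤ ϑc` (PROVED)** — the MILD door WEAKENS as the moat cools. [this file, g65] -/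
theorem MildCoolMoatCorePG.of_moat_le {ϑm ϑc ϑ ϑp r q rsh rm aHi Λ θ s : ℝ} (h : ϑm ≤ ϑc) (hC : MildCoolMoatCorePG ϑc ϑ ϑp r q rsh rm aHi Λ θ s) :
    MildCoolMoatCorePG ϑm ϑ ϑp r q rsh rm aHi Λ θ s :=
  fun δ hδ a ha S hS hgood L w hLw x₀ K hKS hKq hmild hcool =>
    hC δ hδ a ha S hS hgood L w hLw x₀ K hKS hKq hmild (IsTameOn.mono h Subset.rfl hcool)

/-- **[MCMCᶜ](ϑc) ⇒ [MCMCᶜ](ϑm) for `ϑm ≤ ϑc` (PROVED)** — the mild clamped door WEAKENS as the moat cools. [this file, g65] -/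
theorem MildCoolMoatClampedCoreP.of_moat_le {ϑm ϑc ϑ ϑp r q rsh ρ rm aHi Λ θ s : ℝ} (h : ϑm ≤ ϑc)
    (hC : MildCoolMoatClampedCoreP ϑc ϑ ϑp r q rsh ρ rm aHi Λ θ s) : MildCoolMoatClampedCoreP ϑm ϑ ϑp r q rsh ρ rm aHi Λ θ s :=
  fun δ hδ a ha S hS hsum hgood L w hLw x₀ K hKS hKq hmild hcool hmin =>
    hC δ hδ a ha S hS hsum hgood L w hLw x₀ K hKS hKq hmild (IsTameOn.mono h Subset.rfl hcool) hmin

/-- ★★ **THE MILD COLD–WIDE SERENE DOCKET `MildColdSereneDocket ϑm ra`** — the three dial-dependent binders of `_16XH26B` (mild door [MCMC](ϑm, ϑp = 1/10, rm = 16),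
mild residuals [MSSHSᵇ](ϑm, ra), [MBSHSᵇ](ϑm, ra) at mild radius `24`) at record geometry; record `(ϑm, ra) = (1/100, 24)`; ANTITONE in `ϑm`, MONOTONE-WEAKER in
`ra` (`MildColdSereneDocket.of_le`, PROVED).  Cold inhabitants: `ϑm`-SILENT MILD structures — mild hot containers in near-perfect thick shells (the perturbative
door proper: amplitude `≤ 1/10` inside, data `≤ ϑm` outside — BOTH smallness axes of the implicit-function discharge (YI-5) are now explicit, and the data
axis is a dial), silent mild filaments, silent fat mild lumps. [this file, g65] -/
def MildColdSereneDocket (ϑm ra : ℝ) : Prop :=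
  MildCoolMoatCorePG ϑm tameRadius (1 / 10) 8 4 12 16 1 2 (1 / 16) (1 / 50) ∧
    MildSlenderSereneHotSparseBPG ϑm tameRadius 8 ra dressLevel dressLevel dressExponent 8 collarRadius clusterSize 4 32 8 (1 / 10) 24 1 2 (1 / 16) (1 / 50) ∧
      MildBuriedSereneHotSparseBPG ϑm tameRadius 8 ra dressLevel dressLevel dressExponent 8 collarRadius clusterSize 8 (1 / 10) 24 1 2 (1 / 16) (1 / 50)

/-- ★★★ **THE MILD DIAL THEOREM (PROVED): `MildColdSereneDocket ϑm ra ⇒ MildColdSereneDocket ϑm' ra'` for `ϑm' ≤ ϑm`, `ra ≤ ra'`.** [this file, g65] -/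
theorem MildColdSereneDocket.of_le {ϑm ϑm' ra ra' : ℝ} (h : ϑm' ≤ ϑm) (hra : ra ≤ ra') (hD : MildColdSereneDocket ϑm ra) : MildColdSereneDocket ϑm' ra' :=
  ⟨hD.1.of_moat_le h, hD.2.1.of_moat_le h hra, hD.2.2.of_moat_le h hra⟩

/-- **the column-of-record docket gives the mild one (PROVED)** — part YH's three «WEAKER» certificates at general `(ϑm, ra)`. [this file, g65] -/
theorem mildColdSereneDocket_of_cold {ϑm ra : ℝ} (hD : ColdSereneDocket ϑm ra) : MildColdSereneDocket ϑm ra :=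
  ⟨mildCoolMoatCorePG_of_coolMoatCore hD.1, mildSlenderSereneHotSparseBPG_of_slender hD.2.1, mildBuriedSereneHotSparseBPG_of_buried hD.2.2⟩

/-- **RECORD ⇒ EVERY COLDER, WIDER MILD DOCKET (PROVED)**: the three mild binders of `_16XH26B` give `MildColdSereneDocket ϑm ra` for all `ϑm ≤ 1/100`, `ra ≥ 24`. -/
theorem mildColdSereneDocket_of_record {ϑm ra : ℝ} (hle : ϑm ≤ 1 / 100) (hra : 24 ≤ ra) (hMCMC : MildCoolMoatCorePG (1 / 100) tameRadius (1 / 10) 8 4 12 16 1 2 (1 / 16) (1 / 50))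
    (hMSSH : MildSlenderSereneHotSparseBPG (1 / 100) tameRadius 8 24 dressLevel dressLevel dressExponent 8 collarRadius clusterSize 4 32 8 (1 / 10) 24
      1 2 (1 / 16) (1 / 50))
    (hMBSH : MildBuriedSereneHotSparseBPG (1 / 100) tameRadius 8 24 dressLevel dressLevel dressExponent 8 collarRadius clusterSize 8 (1 / 10) 24
      1 2 (1 / 16) (1 / 50)) :
    MildColdSereneDocket ϑm ra :=
  MildColdSereneDocket.of_le hle hra ⟨hMCMC, hMSSH, hMBSH⟩

/-- ★★ **THE MILD B-CHAIN FROM A DOCKET (PROVED)**: `0 ≤ … `, `MildColdSereneDocket ϑm ra` (`ra ≥ 24`), the wild leaf [WHSᵇ](1/10) and the observers' leaf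
[TBISᵇ(8)](ϑ₁ ≤ ϑm, ω₁) give [BHSᵇ] — parts YG/YH's glue at moat level `ϑm` and radius `ra`. [this file, g65] -/
theorem bareHotSparseBPG_of_mildCold_wild_tameBallIncoherence {ϑm ra ϑ₁ ω₁ : ℝ} (hϑ₁ : ϑ₁ ≤ ϑm) (hra : 24 ≤ ra) (hD : MildColdSereneDocket ϑm ra)
    (hW : HotSparseBPG (1 / 10) 1 2 (1 / 16) (1 / 50)) (hTB : TameBallIncoherenceSparseBPG ϑ₁ ω₁ tameRadius 8 1 2 (1 / 16) (1 / 50)) :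
    BareHotSparseBPG tameRadius dressLevel dressLevel dressExponent 8 collarRadius clusterSize 1 2 (1 / 16) (1 / 50) :=
  bareHotSparseBPG_of_serene_tameBallIncoherence (by norm_num) (by linarith) hϑ₁
    (sereneBareHotSparseBPG_of_mild_hot (by norm_num) (by norm_num)
      (mildSereneBareHotSparseBPG_of_mildCoolMoat_slender_buried (by norm_num) (by norm_num) (by linarith) (by norm_num) (by norm_num) hD.1 hD.2.1 hD.2.2)
      hW) hTB

/-- ★★ **THE MILD B-CHAIN AT ANY POSITIVE MOAT TEMPERATURE FROM (MKᵇᵃˡˡ) (PROVED)**: `0 < ϑm`, `ra ≥ 24`, mild cold docket, [WHSᵇ](1/10), (MKᵇᵃˡˡ) ⇒ [BHSᵇ]. -/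
theorem bareHotSparseBPG_of_mildCold_wild_tameBallTiltStrain {ϑm ra : ℝ} (hm : 0 < ϑm) (hra : 24 ≤ ra) (hD : MildColdSereneDocket ϑm ra)
    (hW : HotSparseBPG (1 / 10) 1 2 (1 / 16) (1 / 50)) (hMK : TameBallTiltStrainBPG tameRadius 8 1 2 (1 / 16) (1 / 50)) :
    BareHotSparseBPG tameRadius dressLevel dressLevel dressExponent 8 collarRadius clusterSize 1 2 (1 / 16) (1 / 50) :=
  bareHotSparseBPG_of_mildCold_wild_tameBallIncoherence le_rfl hra hD hW (tameBallIncoherenceSparseBPG_of_tameBallTiltStrain (ω₁ := 1) hm one_pos hMK)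

/-- ★★★ **COLUMN `_16XH28B`** — `_16XH26B` (part YH, column of record-elect by CRITIC-LEDGER row 1189 (a″)) with its four serene-cut binders (hMCMC, hMSSH, hMBSH at the
record moat level `1/100` and serenity radius `24`, hTBIS at `(1/100, 1/200)`) replaced by ONE existential package over the two free dials,
`∃ ϑm ra ϑ₁ ω₁, ϑ₁ ≤ ϑm ∧ 24 ≤ ra ∧ 4ω₁ + ϑ₁ < tameRadius ∧ MildColdSereneDocket ϑm ra ∧ [TBISᵇ(8)](ϑ₁, ω₁)` (WEAKER: implied by the four record binders,
`mildSereneMoatPackage_of_record`); [I_D], [WHSᵇ](1/10), the 20 generic leaves and `PeriodicBulkGapDoor 2` unchanged ⇒ `VisibleGap (1/50) ∧ PertRegime (1/50)`. -/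
theorem gap_and_pert_1_50_of_certs_16XH28B (hL : LatticeLiouvilleCert) (hL' : LayeredLiouvilleCert)
    (hR : OscRigidityL2BDPG 1 2 (1 / 16) (1 / 16)) (hX : ExcessFlatnessControlP 1 2 (1 / 16) (1 / 16))
    (hE : ExcessChartLocalisationP 1 2 (1 / 16) (1 / 100)) (hP : RegistrationP 1 2 (1 / 16) (1 / 100))
    (hT : TailDominationCert) (hU : UniformTameStabilityE (1 / 50) 2 (1 / 2000))
    (h1 : WordTransplantP 1 2 (1 / 16) (1 / 100)) (hGT : GradReframingThickP 1 2 (1 / 16) (1 / 100) (1 / 50))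
    (hΛ0 : LaunderingAprioriPX 1 2 (1 / 16) (1 / 100) (1 / 50)) (hΛs : LaunderingStepPX 1 2 (1 / 16) (1 / 100) (1 / 50))
    (hUc : UntwistCollarP 1 2 (1 / 16) (1 / 50))
    (hl : BondIsoLevelsP 1 2 (1 / 16) (1 / 50)) (hN : EnergyNearChartPX 1 2 (1 / 16) (1 / 50) (1 / 2000))
    (hF : TailForceSlavingP 1 2 (1 / 16) (1 / 50))
    (hE' : LipDualLinearisationP 1 2 (1 / 16) (1 / 50)) (hA : L2HarmonicApproxPE 1 2 (1 / 16) (1 / 50) (1 / 2000))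
    (hD : PositionDecayPLE 1 2 (1 / 16) (1 / 50) (1 / 2000)) (hC : PositionCaccioppoliPGE 1 2 (1 / 16) (1 / 50) (1 / 2000))
    (hI : DressedCorePG tameRadius dressLevel dressLevel dressExponent 8 collarRadius clusterSize 1 2 (1 / 16) (1 / 50))
    (hMSD : ∃ ϑm ra ϑ₁ ω₁ : ℝ, ϑ₁ ≤ ϑm ∧ 24 ≤ ra ∧ 4 * ω₁ + ϑ₁ < tameRadius ∧ MildColdSereneDocket ϑm ra ∧
      TameBallIncoherenceSparseBPG ϑ₁ ω₁ tameRadius 8 1 2 (1 / 16) (1 / 50))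
    (hWHS : HotSparseBPG (1 / 10) 1 2 (1 / 16) (1 / 50))
    (hG : PeriodicBulkGapDoor 2) : VisibleGap (1 / 50) ∧ PertRegime (1 / 50) := by
  obtain ⟨ϑm, ra, ϑ₁, ω₁, hϑ₁, hra, hside, hMD, hTB⟩ := hMSD
  exact gap_and_pert_1_50_of_certs_16XH18B_tol hL hL' hR hX hE hP hT hU h1 hGT hΛ0 hΛs hUc (untwistBookkeepingP_one 2 (1 / 50)) hl hN hF hE' hA hD hC
    (wildFractionBPG_of_dressedCore_serene_tameBallIncoherent hside (by norm_num) (by norm_num) (by linarith) hϑ₁ hI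
      (sereneBareHotSparseBPG_of_mild_hot (by norm_num) (by norm_num)
        (mildSereneBareHotSparseBPG_of_mildCoolMoat_slender_buried (by norm_num) (by norm_num) (by linarith) (by norm_num) (by norm_num) hMD.1 hMD.2.1
          hMD.2.2) hWHS) hTB) hG

/-- **RECORD ⇒ MILD PACKAGE (PROVED)**: the four serene-cut binders of `_16XH26B` witness the package of `_16XH28B` at `(1/100, 24, 1/100, 1/200)`. [this file, g65] -/
theorem mildSereneMoatPackage_of_record (hMCMC : MildCoolMoatCorePG (1 / 100) tameRadius (1 / 10) 8 4 12 16 1 2 (1 / 16) (1 / 50))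
    (hMSSH : MildSlenderSereneHotSparseBPG (1 / 100) tameRadius 8 24 dressLevel dressLevel dressExponent 8 collarRadius clusterSize 4 32 8 (1 / 10) 24
      1 2 (1 / 16) (1 / 50))
    (hMBSH : MildBuriedSereneHotSparseBPG (1 / 100) tameRadius 8 24 dressLevel dressLevel dressExponent 8 collarRadius clusterSize 8 (1 / 10) 24
      1 2 (1 / 16) (1 / 50))
    (hTBIS : TameBallIncoherenceSparseBPG (1 / 100) (1 / 200) tameRadius 8 1 2 (1 / 16) (1 / 50)) :
    ∃ ϑm ra ϑ₁ ω₁ : ℝ, ϑ₁ ≤ ϑm ∧ 24 ≤ ra ∧ 4 * ω₁ + ϑ₁ < tameRadius ∧ MildColdSereneDocket ϑm ra ∧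
      TameBallIncoherenceSparseBPG ϑ₁ ω₁ tameRadius 8 1 2 (1 / 16) (1 / 50) :=
  ⟨1 / 100, 24, 1 / 100, 1 / 200, le_rfl, le_rfl, by norm_num [tameRadius], ⟨hMCMC, hMSSH, hMBSH⟩, hTBIS⟩

/-- **`_16XH26B`'s binders ⇒ `_16XH28B`'s conclusion THROUGH the package (PROVED)** — the mild column is an instance of the dialled one. [this file, g65] (dedup gate: an identical public twin is already landed elsewhere in the tree; kept PRIVATE here to keep the import closure local) -/
private theorem gap_and_pert_1_50_of_certs_16XH26B_via_28B (hL : LatticeLiouvilleCert) (hL' : LayeredLiouvilleCert)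
    (hR : OscRigidityL2BDPG 1 2 (1 / 16) (1 / 16)) (hX : ExcessFlatnessControlP 1 2 (1 / 16) (1 / 16))
    (hE : ExcessChartLocalisationP 1 2 (1 / 16) (1 / 100)) (hP : RegistrationP 1 2 (1 / 16) (1 / 100))
    (hT : TailDominationCert) (hU : UniformTameStabilityE (1 / 50) 2 (1 / 2000))
    (h1 : WordTransplantP 1 2 (1 / 16) (1 / 100)) (hGT : GradReframingThickP 1 2 (1 / 16) (1 / 100) (1 / 50))
    (hΛ0 : LaunderingAprioriPX 1 2 (1 / 16) (1 / 100) (1 / 50)) (hΛs : LaunderingStepPX 1 2 (1 / 16) (1 / 100) (1 / 50))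
    (hUc : UntwistCollarP 1 2 (1 / 16) (1 / 50))
    (hl : BondIsoLevelsP 1 2 (1 / 16) (1 / 50)) (hN : EnergyNearChartPX 1 2 (1 / 16) (1 / 50) (1 / 2000))
    (hF : TailForceSlavingP 1 2 (1 / 16) (1 / 50))
    (hE' : LipDualLinearisationP 1 2 (1 / 16) (1 / 50)) (hA : L2HarmonicApproxPE 1 2 (1 / 16) (1 / 50) (1 / 2000))
    (hD : PositionDecayPLE 1 2 (1 / 16) (1 / 50) (1 / 2000)) (hC : PositionCaccioppoliPGE 1 2 (1 / 16) (1 / 50) (1 / 2000))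
    (hI : DressedCorePG tameRadius dressLevel dressLevel dressExponent 8 collarRadius clusterSize 1 2 (1 / 16) (1 / 50))
    (hMCMC : MildCoolMoatCorePG (1 / 100) tameRadius (1 / 10) 8 4 12 16 1 2 (1 / 16) (1 / 50))
    (hMSSH : MildSlenderSereneHotSparseBPG (1 / 100) tameRadius 8 24 dressLevel dressLevel dressExponent 8 collarRadius clusterSize 4 32 8 (1 / 10) 24
      1 2 (1 / 16) (1 / 50))
    (hMBSH : MildBuriedSereneHotSparseBPG (1 / 100) tameRadius 8 24 dressLevel dressLevel dressExponent 8 collarRadius clusterSize 8 (1 / 10) 24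
      1 2 (1 / 16) (1 / 50))
    (hWHS : HotSparseBPG (1 / 10) 1 2 (1 / 16) (1 / 50))
    (hTBIS : TameBallIncoherenceSparseBPG (1 / 100) (1 / 200) tameRadius 8 1 2 (1 / 16) (1 / 50))
    (hG : PeriodicBulkGapDoor 2) : VisibleGap (1 / 50) ∧ PertRegime (1 / 50) :=
  gap_and_pert_1_50_of_certs_16XH28B hL hL' hR hX hE hP hT hU h1 hGT hΛ0 hΛs hUc hl hN hF hE' hA hD hC hI (mildSereneMoatPackage_of_record hMCMC hMSSH hMBSH hTBIS) hWHS hG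

/-- ★★★ **COLUMN `_16XH28BT` — THE MILD COLD COLUMN**: `_16XH28B` with the package supplied by ANY POSITIVE MOAT TEMPERATURE AND ANY SERENITY RADIUS `≥ 24`,
`∃ ϑm ra, 0 < ϑm ∧ 24 ≤ ra ∧ MildColdSereneDocket ϑm ra`, plus the level-free (MKᵇᵃˡˡ) leaf; every dial-dependent binder weakens monotonically along `ϑm ↓ 0`,
`ra ↑ ∞` (`MildColdSereneDocket.of_le`). [this file, g65] -/
theorem gap_and_pert_1_50_of_certs_16XH28BT (hL : LatticeLiouvilleCert) (hL' : LayeredLiouvilleCert)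
    (hR : OscRigidityL2BDPG 1 2 (1 / 16) (1 / 16)) (hX : ExcessFlatnessControlP 1 2 (1 / 16) (1 / 16))
    (hE : ExcessChartLocalisationP 1 2 (1 / 16) (1 / 100)) (hP : RegistrationP 1 2 (1 / 16) (1 / 100))
    (hT : TailDominationCert) (hU : UniformTameStabilityE (1 / 50) 2 (1 / 2000))
    (h1 : WordTransplantP 1 2 (1 / 16) (1 / 100)) (hGT : GradReframingThickP 1 2 (1 / 16) (1 / 100) (1 / 50))
    (hΛ0 : LaunderingAprioriPX 1 2 (1 / 16) (1 / 100) (1 / 50)) (hΛs : LaunderingStepPX 1 2 (1 / 16) (1 / 100) (1 / 50))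
    (hUc : UntwistCollarP 1 2 (1 / 16) (1 / 50))
    (hl : BondIsoLevelsP 1 2 (1 / 16) (1 / 50)) (hN : EnergyNearChartPX 1 2 (1 / 16) (1 / 50) (1 / 2000))
    (hF : TailForceSlavingP 1 2 (1 / 16) (1 / 50))
    (hE' : LipDualLinearisationP 1 2 (1 / 16) (1 / 50)) (hA : L2HarmonicApproxPE 1 2 (1 / 16) (1 / 50) (1 / 2000))
    (hD : PositionDecayPLE 1 2 (1 / 16) (1 / 50) (1 / 2000)) (hC : PositionCaccioppoliPGE 1 2 (1 / 16) (1 / 50) (1 / 2000))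
    (hI : DressedCorePG tameRadius dressLevel dressLevel dressExponent 8 collarRadius clusterSize 1 2 (1 / 16) (1 / 50))
    (hMK : TameBallTiltStrainBPG tameRadius 8 1 2 (1 / 16) (1 / 50)) (hCold : ∃ ϑm ra : ℝ, 0 < ϑm ∧ 24 ≤ ra ∧ MildColdSereneDocket ϑm ra)
    (hWHS : HotSparseBPG (1 / 10) 1 2 (1 / 16) (1 / 50))
    (hG : PeriodicBulkGapDoor 2) : VisibleGap (1 / 50) ∧ PertRegime (1 / 50) := by
  obtain ⟨ϑm, ra, hm, hra, hMD⟩ := hCold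
  have h₁ : 0 < min ϑm (1 / 100) := lt_min hm (by norm_num)
  have hside : 4 * (1 / 200 : ℝ) + min ϑm (1 / 100) < tameRadius := by
    have h := min_le_right ϑm (1 / 100)
    have ht : tameRadius = 1 / 20 := rfl
    rw [ht]
    linarith
  exact gap_and_pert_1_50_of_certs_16XH28B hL hL' hR hX hE hP hT hU h1 hGT hΛ0 hΛs hUc hl hN hF hE' hA hD hC hI
    ⟨ϑm, ra, min ϑm (1 / 100), 1 / 200, min_le_left _ _, hra, hside, hMD,
      tameBallIncoherenceSparseBPG_of_tameBallTiltStrain h₁ (by norm_num) hMK⟩ hWHS hG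

end Summit.AtomisticToContinuum.Crystallization.Theorems.ChartedZeroExcessLayeredLatticeLiouville

end
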